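import Summits.QuantumFields.YangMills.Theorems.BalabanUVNodesN20KeyedRelWeightSocket
import Summits.QuantumFields.YangMills.Theorems.BalabanUVNodesN21KeyedShellWeightSocket
import Summits.QuantumFields.YangMills.Theorems.BalabanUVNodesSpineReadingOfRecord13CoPH

/-!
# BalabanUVNodes ∕ N20 (NE7b) — THE INSTANCE SOCKET REWRITTEN AT THE SPINE READING OF RECORD `crOfRecord₁₃At K₀ jcut sh` (dag-n20-d, plan g78 WORD-CR13):
# `KeyedRelWeight` ∕ `S_N20 (SRec₁₃CoPH (crOfRecord₁₃At …))` ⟺ per admissible Stage-13 tuple, SOME summable sub-unit majorant `W` of the relative class weight of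
# run A's (2.18) sequences WITH AN OLD LARGE-FIELD REGION AT A LEVEL `≤ jcut K` and of run B's — two DISPLAYED TERM-LEVEL statements, nothing else

Cell `pub-ymgap` (HUMAN RULING D-0062 Track A; director-ym №197 ∕ HUMAN RULING D-0149 width seats), seat `pub-ymgap-dag-n20-w1` (N20 NE7b WIDTH SEAT 1 of 3) gen 0,
module 2.  Plan g78 `W-SEAT-START-LIST.md` v4 §0 READING-OF-RECORD DECLARER: «the three w-faces (n20-w1 `KeyedRelWeight`, …) stay at the PARAMETER `cr` … and rewrite at
`crOfRecord₁₃` with the dictionary lemmas the hour it lands» — this is that rewrite for the `KeyedRelWeight` face.  Filed `--kind proof --supports stmt-QuantumFields-20544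
--as helper` (K3⁷ `SpineGivenEndpointR13SepCoPH`); COUNT-NEUTRAL.  [III] = [Balaban1988Convergent], [LF-II] = [Balaban1989LargeFieldII].

WHAT IS TYPED (theorems only; 0 `def`, 0 `sorry`; module 1 `…N20KeyedRelWeightSocket` §1 + dag-n20-d's `…SpineReadingOfRecord13CoPH` (objects `classSet₁₃ ∕ weightA₁₃ ∕ weightB₁₃ ∕
badClass₁₃ ∕ keyA₁₃ ∕ keyB₁₃ ∕ crOfRecord₁₃At`, dictionary `crOfRecord₁₃At_*`, transfer `relWeightBound_crOfRecord₁₃At`, canonical weight `SpineCanonicalWeights.wInf`) + dag-n20-d's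
`Node00/TwoRunSitePersistence` (`KeyOldLargeField`, `mem_badKeysSigma_iff`) + dag-n19-d's homes (`s_N20_sRec₁₃CoPH_iff`, `s_N20_sRec₁₃CoPHOn_iff`) BY NAME):
* §1 AT ONE TUPLE's CARRIERS OF RECORD (`θ, hP, K₀, g₀, os, jcut`; the class weights are NODE 00's `classWeightOfDatum₉ F N θ.toStage9Params (datumOfRecord₁₃CoPH F N θ hP) g₀ os`
  at the run letters of record `runA₁₃ ∕ runB₁₃`, `histA₁₃ ∕ histB₁₃`): `keyA₁₃_mem_classSet₁₃` · `keyB₁₃_mem_classSet₁₃` · `keyB₁₃_fst` · `keyA₁₃_mem_badClass₁₃_iff` · `keyB₁₃_mem_badClass₁₃_iff`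
  («the key is bad» ⟺ `KeyOldLargeField (jcut K)` on the key's site-set pair; run A: ⟺ `∃ j, 1 ≤ j ≤ jcut K ∧ s.Λ j ≠ T_η`, `Iff.rfl`) · ★ `relWeightBound_carriersOfRecord₁₃_of_termBounds`
  (a witness `W`, `0 ≤ W < 1`, `Σ W < ∞`, and the two term-level bounds ⇒ `RelWeightBound 1 (classSet₁₃ …) (weightA₁₃ …) (weightB₁₃ …) (badClass₁₃ … jcut) W`) ·
  ★ `termBounds_of_relWeightBound_carriersOfRecord₁₃` (converse) · ★ `relWeightBound_carriersOfRecord₁₃_iff_termBounds`.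
* §2 AT THE READING `crOfRecord₁₃At K₀ jcut sh` (its `W` is the CANONICAL least admissible weight `wInf`, so ANY witness transfers — dag-n20-d §6):
  ★★ `relWeightBound_crOfRecord₁₃At_of_termBounds` (one tuple) · ★★ `relWeightBound_crOfRecord₁₃At_iff_exists_termBounds` (one tuple, IFF) ·
  ★★ `s_N20_sRec₁₃CoPH_crOfRecord₁₃At_iff` (THE NODE AT THE RECORD: `S_N20 (SRec₁₃CoPH (crOfRecord₁₃At K₀ jcut sh))` ⟺ ∀ admissible tuples ∃ such `W`) ·
  ★★ `s_N20_sRec₁₃CoPHOn_crOfRecord₁₃At_of_termBounds` + `relWeightBound_guarded_crOfRecord₁₃At_of_termBounds` (regime-guarded = leaf D's `h20` ∕ the K3 skeleton's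
  `KeyedRelWeight` binder shape at `cr := crOfRecord₁₃At …`, `Rg` e.g. `θ.ZhUnity F N ∧ θ.SlotsNondegenerate₁₃ F N`).
* §3 THE SHELL FACE AT THE SAME READING (module `…N21KeyedShellWeightSocket` §1 + dag-n20-d's `shellWeightBound_crOfRecord₁₃At`): ★★ `shellWeightBound_crOfRecord₁₃At_of_termShell`
  (a reading whose keyed shell split IS the fibre sum of term-level pieces — displayed equations — carries `ShellWeightBound` from the term-level clauses) ·
  ★★ `s_N21_sRec₁₃CoPH_crOfRecord₁₃At_of_termShell`.

(α) READING ∕ PIN CONSTRAINT (dag-n20-d's header, adopted): at this reading `Bad := badClass₁₃ … jcut = badKeysSigma F (classSet₁₃ …) jcut` = «a large-field region EXISTS at a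
level `≤ jcut K`» on the (2.18) key; dag-n20-w3 LOCATED-1 (pub-ymgap INBOX l.24338, confirmed by dag-n20-d l.24693): at an identity∕junk pin of `θ.ppSel` that class is
«ever created» and its complement is asymptotically weightless, so the right-hand side below is NOT to be expected there with `Summable W` — the equivalence then records
exactly WHAT would have to hold; at the history-rewriting pin it reads NE7b's «old AND pending».  This file decides no pin and no reading.

HONEST FRAMING.  Count-neutral kernel bookkeeping (finite sums + an infimum transfer BY NAME).  It proves NO estimate: the right-hand sides (term-level relative bounds for
Bałaban's class weights) are node N20's XL body — NAMED OPEN, inhabited for no Bałaban family today (A6: LOCATED, see the pin constraint; every ★★ is an EQUIVALENCE or its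
easy direction, so nothing is smuggled); NE7b is the cell `pub-balaban`'s OWN estimate — NOT PRINTED for d = 4, NOT PROVED ([King1986] (3.10)–(3.11) p. 656 is the printed
MODEL); no `Provisos₁₃CoPH` inhabitant claimed; (α)-instance 0∕1; N20 NOT discharged; K3⁷ NOT closed; counts unmoved (typed 28∕28 · discharged 5∕27).  One finite
`𝕋⁴_{L^K}` programme at fixed `ε = L^{−K}`, Bałaban AS PRINTED; the YM mass gap (Clay) is NOT proved by any of this — R4 closes the conditional finite-𝕋⁴ rung
`BalabanLadder.UV` only; nothing continuum ∕ ℝ⁴ ∕ OS.  No `instance`, no `notation`, no `def`.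
Sources (locators only): [III] (2.18) p. 257; [LF-II] (1.80) p. 384, (1.85)–(1.89) pp. 386–387; [King1986] (3.10) p. 656.  No decl below carries a cite tag.
-/

noncomputable section

namespace Summit.QuantumFields.YangMills.BalabanUVNodes.N20KeyedRelWeightSocketAtRecord13CoPH

open Literature.MathematicalPhysics.QuantumFieldTheory.Balaban1983to89 Literature.MathematicalPhysics.QuantumFieldTheory.Balaban1983to89.Node00
open scoped BigOperators
open T4Continuum B14.Eq218Concrete Summit.QuantumFields.BalabanUV.T4Continuum.Spine
open T4WeightBudget (RelWeightBound)
open YMDAG.UVSplit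
open Summit.QuantumFields.YangMills.BalabanUVNodes.SpineCanonicalWeights (wInf relWeightBound_wInf_iff)
open Summit.QuantumFields.YangMills.BalabanUVNodes.N20KeyedRelWeightSocket
open Summit.QuantumFields.YangMills.BalabanUVNodes.N21KeyedShellWeightSocket (shellWeightBound_keyed_of_termShell)
open T4IndicatorShell (ShellWeightBound)

variable {F : T4Family} {N : ℕ} [NeZero N]

/-! ## §1 At one tuple's carriers of record: the keyed `RelWeightBound` ⟺ two term-level bounds on the sequences with an old large-field region -/

section Carriers

variable (θ : Stage13HParams F N) (hP : θ.Provisos₁₃CoPH F N) (K₀ : ℕ) (g₀ : ℕ → ℝ) (os : List (ULoop F)) (jcut : ℕ → ℕ)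

/-- Run A's key of record lies in the class set of record. [bookkeeping] -/
theorem keyA₁₃_mem_classSet₁₃ (K : ℕ) (s : SeqOfRecord F θ.ν θ.τ9.M (histA₁₃ θ K₀ g₀ K) (K₀ + K) (K₀ + K)) :
    keyA₁₃ θ K₀ g₀ K s ∈ classSet₁₃ θ K₀ g₀ K := by
  letI : ∀ Kc, DecidableEq (SiteSeqKey F Kc) := fun _ => Classical.decEq _
  unfold classSet₁₃
  exact Finset.mem_union_left _ (Finset.mem_image_of_mem _ (Finset.mem_univ s))

/-- Run B's key of record lies in the class set of record. [bookkeeping] -/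
theorem keyB₁₃_mem_classSet₁₃ (K : ℕ) (s' : SeqOfRecord F θ.ν θ.τ9.M (histB₁₃ θ K₀ g₀ K) (K₀ + K + 1) (K₀ + K + 1)) :
    keyB₁₃ θ K₀ g₀ K s' ∈ classSet₁₃ θ K₀ g₀ K := by
  letI : ∀ Kc, DecidableEq (SiteSeqKey F Kc) := fun _ => Classical.decEq _
  unfold classSet₁₃
  exact Finset.mem_union_right _ (Finset.mem_image_of_mem _ (Finset.mem_univ s'))

/-- Run B's key of record sits over its own cutoff index (both branches of the total key). [bookkeeping] -/
theorem keyB₁₃_fst (K : ℕ) (s' : SeqOfRecord F θ.ν θ.τ9.M (histB₁₃ θ K₀ g₀ K) (K₀ + K + 1) (K₀ + K + 1)) :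
    (keyB₁₃ θ K₀ g₀ K s').1 = K := by
  unfold keyB₁₃
  split <;> rfl

/-- **«RUN A's KEY IS BAD» ⟺ AN OLD LARGE-FIELD REGION AT A LEVEL `≤ jcut K`** (`mem_badKeysSigma_iff`; the key is a class automatically).  By `keyOldLargeField_twoRunKeyA_iff`
(`Iff.rfl`) the right-hand side is `∃ j, 1 ≤ j ∧ j ≤ jcut K ∧ s.Λ j ≠ Set.univ` — a property of the single (2.18) term. [bookkeeping] -/
theorem keyA₁₃_mem_badClass₁₃_iff (K : ℕ) (t : ℝ) (s : SeqOfRecord F θ.ν θ.τ9.M (histA₁₃ θ K₀ g₀ K) (K₀ + K) (K₀ + K)) :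
    keyA₁₃ θ K₀ g₀ K s ∈ badClass₁₃ θ K₀ g₀ jcut K t ↔ KeyOldLargeField (jcut K) (keyA₁₃ θ K₀ g₀ K s).2 := by
  unfold badClass₁₃
  rw [mem_badKeysSigma_iff]
  exact ⟨fun h => h.2, fun h => ⟨keyA₁₃_mem_classSet₁₃ θ K₀ g₀ K s, h⟩⟩

/-- **«RUN B's KEY IS BAD» ⟺ AN OLD LARGE-FIELD REGION AT A LEVEL `≤ jcut K` ON THE BLOCK-DOWN KEY** (a whole block-down fibre is bad or not; under `0 < θ.τ9.M` and
`jcut K ≤ K₀ + K` read it through `keyB₁₃_eq` + `keyOldLargeField_twoRunKeyB_iff`). [bookkeeping] -/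
theorem keyB₁₃_mem_badClass₁₃_iff (K : ℕ) (t : ℝ) (s' : SeqOfRecord F θ.ν θ.τ9.M (histB₁₃ θ K₀ g₀ K) (K₀ + K + 1) (K₀ + K + 1)) :
    keyB₁₃ θ K₀ g₀ K s' ∈ badClass₁₃ θ K₀ g₀ jcut K t ↔ KeyOldLargeField (jcut K) (keyB₁₃ θ K₀ g₀ K s').2 := by
  unfold badClass₁₃
  rw [mem_badKeysSigma_iff, show jcut (keyB₁₃ θ K₀ g₀ K s').1 = jcut K by rw [keyB₁₃_fst]]
  exact ⟨fun h => h.2, fun h => ⟨keyB₁₃_mem_classSet₁₃ θ K₀ g₀ K s', h⟩⟩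

open Classical in
/-- ★ **THE KEYED `RelWeightBound` AT THE CARRIERS OF RECORD FROM TWO TERM-LEVEL BOUNDS.**  For a witness `W` with `0 ≤ W < 1`, `Σ W < ∞`: IF run A's (2.18) sequences at
cutoff `K₀ + K` with an old large-field region at a level `≤ jcut K` carry relative class weight `≤ W K`, and run B's at cutoff `K₀ + K + 1` (bad through their block-down key)
likewise, uniformly in `|t| ≤ 1` — THE BODY OF N20, DISPLAYED, NOT PROVED — THEN `RelWeightBound 1 (classSet₁₃ …) (weightA₁₃ …) (weightB₁₃ …) (badClass₁₃ … jcut) W`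
(module 1 §1 `relWeightBound_keyed_of_termBounds`; `bad_subset` = dag-n20-d's `badClass₁₃_subset`). [bookkeeping] -/
theorem relWeightBound_carriersOfRecord₁₃_of_termBounds {W : ℕ → ℝ} (hW0 : ∀ K, 0 ≤ W K) (hW1 : ∀ K, W K < 1) (hWs : Summable W)
    (hA : ∀ (K : ℕ) (t : ℝ), |t| ≤ 1 →
      ∑ s ∈ Finset.univ.filter (fun s : SeqOfRecord F θ.ν θ.τ9.M (histA₁₃ θ K₀ g₀ K) (K₀ + K) (K₀ + K) => KeyOldLargeField (jcut K) (keyA₁₃ θ K₀ g₀ K s).2),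
          classWeightOfDatum₉ F N θ.toStage9Params (datumOfRecord₁₃CoPH F N θ hP) g₀ os (runA₁₃ F K₀ g₀ K) (histA₁₃ θ K₀ g₀ K) (K₀ + K) t s
        ≤ W K * ∑ s, classWeightOfDatum₉ F N θ.toStage9Params (datumOfRecord₁₃CoPH F N θ hP) g₀ os (runA₁₃ F K₀ g₀ K) (histA₁₃ θ K₀ g₀ K) (K₀ + K) t s)
    (hB : ∀ (K : ℕ) (t : ℝ), |t| ≤ 1 →
      ∑ s' ∈ Finset.univ.filter (fun s' : SeqOfRecord F θ.ν θ.τ9.M (histB₁₃ θ K₀ g₀ K) (K₀ + K + 1) (K₀ + K + 1) => KeyOldLargeField (jcut K) (keyB₁₃ θ K₀ g₀ K s').2),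
          classWeightOfDatum₉ F N θ.toStage9Params (datumOfRecord₁₃CoPH F N θ hP) g₀ os (runB₁₃ F K₀ g₀ K) (histB₁₃ θ K₀ g₀ K) (K₀ + K + 1) t s'
        ≤ W K * ∑ s', classWeightOfDatum₉ F N θ.toStage9Params (datumOfRecord₁₃CoPH F N θ hP) g₀ os (runB₁₃ F K₀ g₀ K) (histB₁₃ θ K₀ g₀ K) (K₀ + K + 1) t s') :
    RelWeightBound 1 (classSet₁₃ θ K₀ g₀) (weightA₁₃ θ hP K₀ g₀ os) (weightB₁₃ θ hP K₀ g₀ os) (badClass₁₃ θ K₀ g₀ jcut) W := by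
  letI : ∀ Kc, DecidableEq (SiteSeqKey F Kc) := fun _ => Classical.decEq _
  have hA' : ∀ (K : ℕ) (t : ℝ), |t| ≤ 1 →
      ∑ s ∈ Finset.univ.filter (fun s : SeqOfRecord F θ.ν θ.τ9.M (histA₁₃ θ K₀ g₀ K) (K₀ + K) (K₀ + K) => keyA₁₃ θ K₀ g₀ K s ∈ badClass₁₃ θ K₀ g₀ jcut K t),
          classWeightOfDatum₉ F N θ.toStage9Params (datumOfRecord₁₃CoPH F N θ hP) g₀ os (runA₁₃ F K₀ g₀ K) (histA₁₃ θ K₀ g₀ K) (K₀ + K) t s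
        ≤ W K * ∑ s, classWeightOfDatum₉ F N θ.toStage9Params (datumOfRecord₁₃CoPH F N θ hP) g₀ os (runA₁₃ F K₀ g₀ K) (histA₁₃ θ K₀ g₀ K) (K₀ + K) t s := by
    intro K t ht
    rw [Finset.filter_congr (fun s _ => keyA₁₃_mem_badClass₁₃_iff θ K₀ g₀ jcut K t s)]
    convert hA K t ht using 2
  have hB' : ∀ (K : ℕ) (t : ℝ), |t| ≤ 1 →
      ∑ s' ∈ Finset.univ.filter (fun s' : SeqOfRecord F θ.ν θ.τ9.M (histB₁₃ θ K₀ g₀ K) (K₀ + K + 1) (K₀ + K + 1) => keyB₁₃ θ K₀ g₀ K s' ∈ badClass₁₃ θ K₀ g₀ jcut K t),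
          classWeightOfDatum₉ F N θ.toStage9Params (datumOfRecord₁₃CoPH F N θ hP) g₀ os (runB₁₃ F K₀ g₀ K) (histB₁₃ θ K₀ g₀ K) (K₀ + K + 1) t s'
        ≤ W K * ∑ s', classWeightOfDatum₉ F N θ.toStage9Params (datumOfRecord₁₃CoPH F N θ hP) g₀ os (runB₁₃ F K₀ g₀ K) (histB₁₃ θ K₀ g₀ K) (K₀ + K + 1) t s' := by
    intro K t ht
    rw [Finset.filter_congr (fun s' _ => keyB₁₃_mem_badClass₁₃_iff θ K₀ g₀ jcut K t s')]
    convert hB K t ht using 2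
  exact relWeightBound_keyed_of_termBounds (keyA₁₃ θ K₀ g₀) (keyB₁₃ θ K₀ g₀)
    (fun K t (s : SeqOfRecord F θ.ν θ.τ9.M (histA₁₃ θ K₀ g₀ K) (K₀ + K) (K₀ + K)) =>
      classWeightOfDatum₉ F N θ.toStage9Params (datumOfRecord₁₃CoPH F N θ hP) g₀ os (runA₁₃ F K₀ g₀ K) (histA₁₃ θ K₀ g₀ K) (K₀ + K) t s)
    (fun K t (s' : SeqOfRecord F θ.ν θ.τ9.M (histB₁₃ θ K₀ g₀ K) (K₀ + K + 1) (K₀ + K + 1)) =>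
      classWeightOfDatum₉ F N θ.toStage9Params (datumOfRecord₁₃CoPH F N θ hP) g₀ os (runB₁₃ F K₀ g₀ K) (histB₁₃ θ K₀ g₀ K) (K₀ + K + 1) t s')
    (keyA₁₃_mem_classSet₁₃ θ K₀ g₀) (keyB₁₃_mem_classSet₁₃ θ K₀ g₀) (fun K t _ => badClass₁₃_subset θ K₀ g₀ jcut K t) hW0 hW1 hWs hA' hB'

open Classical in
/-- ★ **THE CONVERSE AT THE CARRIERS OF RECORD**: a keyed `RelWeightBound 1 (classSet₁₃ …) (weightA₁₃ …) (weightB₁₃ …) (badClass₁₃ … jcut) W` SAYS the two term-level bounds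
(module 1 §1 `termBounds_of_relWeightBound_keyed`). [bookkeeping] -/
theorem termBounds_of_relWeightBound_carriersOfRecord₁₃ {W : ℕ → ℝ}
    (h : RelWeightBound 1 (classSet₁₃ θ K₀ g₀) (weightA₁₃ θ hP K₀ g₀ os) (weightB₁₃ θ hP K₀ g₀ os) (badClass₁₃ θ K₀ g₀ jcut) W) :
    (∀ (K : ℕ) (t : ℝ), |t| ≤ 1 →
      ∑ s ∈ Finset.univ.filter (fun s : SeqOfRecord F θ.ν θ.τ9.M (histA₁₃ θ K₀ g₀ K) (K₀ + K) (K₀ + K) => KeyOldLargeField (jcut K) (keyA₁₃ θ K₀ g₀ K s).2),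
          classWeightOfDatum₉ F N θ.toStage9Params (datumOfRecord₁₃CoPH F N θ hP) g₀ os (runA₁₃ F K₀ g₀ K) (histA₁₃ θ K₀ g₀ K) (K₀ + K) t s
        ≤ W K * ∑ s, classWeightOfDatum₉ F N θ.toStage9Params (datumOfRecord₁₃CoPH F N θ hP) g₀ os (runA₁₃ F K₀ g₀ K) (histA₁₃ θ K₀ g₀ K) (K₀ + K) t s) ∧
    (∀ (K : ℕ) (t : ℝ), |t| ≤ 1 →
      ∑ s' ∈ Finset.univ.filter (fun s' : SeqOfRecord F θ.ν θ.τ9.M (histB₁₃ θ K₀ g₀ K) (K₀ + K + 1) (K₀ + K + 1) => KeyOldLargeField (jcut K) (keyB₁₃ θ K₀ g₀ K s').2),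
          classWeightOfDatum₉ F N θ.toStage9Params (datumOfRecord₁₃CoPH F N θ hP) g₀ os (runB₁₃ F K₀ g₀ K) (histB₁₃ θ K₀ g₀ K) (K₀ + K + 1) t s'
        ≤ W K * ∑ s', classWeightOfDatum₉ F N θ.toStage9Params (datumOfRecord₁₃CoPH F N θ hP) g₀ os (runB₁₃ F K₀ g₀ K) (histB₁₃ θ K₀ g₀ K) (K₀ + K + 1) t s') := by
  letI : ∀ Kc, DecidableEq (SiteSeqKey F Kc) := fun _ => Classical.decEq _
  obtain ⟨hA', hB'⟩ := termBounds_of_relWeightBound_keyed (keyA₁₃ θ K₀ g₀) (keyB₁₃ θ K₀ g₀)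
    (fun K t (s : SeqOfRecord F θ.ν θ.τ9.M (histA₁₃ θ K₀ g₀ K) (K₀ + K) (K₀ + K)) =>
      classWeightOfDatum₉ F N θ.toStage9Params (datumOfRecord₁₃CoPH F N θ hP) g₀ os (runA₁₃ F K₀ g₀ K) (histA₁₃ θ K₀ g₀ K) (K₀ + K) t s)
    (fun K t (s' : SeqOfRecord F θ.ν θ.τ9.M (histB₁₃ θ K₀ g₀ K) (K₀ + K + 1) (K₀ + K + 1)) =>
      classWeightOfDatum₉ F N θ.toStage9Params (datumOfRecord₁₃CoPH F N θ hP) g₀ os (runB₁₃ F K₀ g₀ K) (histB₁₃ θ K₀ g₀ K) (K₀ + K + 1) t s')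
    (T := classSet₁₃ θ K₀ g₀) (Bad := badClass₁₃ θ K₀ g₀ jcut) (keyA₁₃_mem_classSet₁₃ θ K₀ g₀) (keyB₁₃_mem_classSet₁₃ θ K₀ g₀) h
  refine ⟨fun K t ht => ?_, fun K t ht => ?_⟩
  · rw [← Finset.filter_congr (fun s _ => keyA₁₃_mem_badClass₁₃_iff θ K₀ g₀ jcut K t s)]
    exact hA' K t ht
  · rw [← Finset.filter_congr (fun s' _ => keyB₁₃_mem_badClass₁₃_iff θ K₀ g₀ jcut K t s')]
    exact hB' K t ht

open Classical in
/-- ★ **THE SOCKET AT THE CARRIERS OF RECORD AS AN EQUIVALENCE** (for a fixed witness `W` with `0 ≤ W < 1`, `Σ W < ∞`). [bookkeeping] -/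
theorem relWeightBound_carriersOfRecord₁₃_iff_termBounds {W : ℕ → ℝ} (hW0 : ∀ K, 0 ≤ W K) (hW1 : ∀ K, W K < 1) (hWs : Summable W) :
    RelWeightBound 1 (classSet₁₃ θ K₀ g₀) (weightA₁₃ θ hP K₀ g₀ os) (weightB₁₃ θ hP K₀ g₀ os) (badClass₁₃ θ K₀ g₀ jcut) W ↔
    ((∀ (K : ℕ) (t : ℝ), |t| ≤ 1 →
      ∑ s ∈ Finset.univ.filter (fun s : SeqOfRecord F θ.ν θ.τ9.M (histA₁₃ θ K₀ g₀ K) (K₀ + K) (K₀ + K) => KeyOldLargeField (jcut K) (keyA₁₃ θ K₀ g₀ K s).2),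
          classWeightOfDatum₉ F N θ.toStage9Params (datumOfRecord₁₃CoPH F N θ hP) g₀ os (runA₁₃ F K₀ g₀ K) (histA₁₃ θ K₀ g₀ K) (K₀ + K) t s
        ≤ W K * ∑ s, classWeightOfDatum₉ F N θ.toStage9Params (datumOfRecord₁₃CoPH F N θ hP) g₀ os (runA₁₃ F K₀ g₀ K) (histA₁₃ θ K₀ g₀ K) (K₀ + K) t s) ∧
    (∀ (K : ℕ) (t : ℝ), |t| ≤ 1 →
      ∑ s' ∈ Finset.univ.filter (fun s' : SeqOfRecord F θ.ν θ.τ9.M (histB₁₃ θ K₀ g₀ K) (K₀ + K + 1) (K₀ + K + 1) => KeyOldLargeField (jcut K) (keyB₁₃ θ K₀ g₀ K s').2),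
          classWeightOfDatum₉ F N θ.toStage9Params (datumOfRecord₁₃CoPH F N θ hP) g₀ os (runB₁₃ F K₀ g₀ K) (histB₁₃ θ K₀ g₀ K) (K₀ + K + 1) t s'
        ≤ W K * ∑ s', classWeightOfDatum₉ F N θ.toStage9Params (datumOfRecord₁₃CoPH F N θ hP) g₀ os (runB₁₃ F K₀ g₀ K) (histB₁₃ θ K₀ g₀ K) (K₀ + K + 1) t s')) :=
  ⟨termBounds_of_relWeightBound_carriersOfRecord₁₃ θ hP K₀ g₀ os jcut,
    fun h => relWeightBound_carriersOfRecord₁₃_of_termBounds θ hP K₀ g₀ os jcut hW0 hW1 hWs h.1 h.2⟩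

end Carriers

/-! ## §2 At the reading of record `crOfRecord₁₃At K₀ jcut sh` — its `W` is canonical, so any witness transfers (dag-n20-d §6 BY NAME) -/

section Reading

variable (K₀ : ℕ) (jcut : ℕ → ℕ) (sh : ShellSplit₁₃CoPH N K₀)

open Classical in
/-- ★★ **N20's FACE AT THE READING OF RECORD, ONE TUPLE, FROM TWO TERM-LEVEL BOUNDS**: a witness `W` (`0 ≤ W < 1`, `Σ W < ∞`) with the two displayed term-level bounds ⇒
`RelWeightBound` AT `crOfRecord₁₃At K₀ jcut sh F θ hP g₀ os` (all six carriers the reading's own, `W` the canonical one; §1 ★ + dag-n20-d's `relWeightBound_crOfRecord₁₃At`).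
[bookkeeping] -/
theorem relWeightBound_crOfRecord₁₃At_of_termBounds (θ : Stage13HParams F N) (hP : θ.Provisos₁₃CoPH F N) (g₀ : ℕ → ℝ) (os : List (ULoop F))
    {W : ℕ → ℝ} (hW0 : ∀ K, 0 ≤ W K) (hW1 : ∀ K, W K < 1) (hWs : Summable W)
    (hA : ∀ (K : ℕ) (t : ℝ), |t| ≤ 1 →
      ∑ s ∈ Finset.univ.filter (fun s : SeqOfRecord F θ.ν θ.τ9.M (histA₁₃ θ K₀ g₀ K) (K₀ + K) (K₀ + K) => KeyOldLargeField (jcut K) (keyA₁₃ θ K₀ g₀ K s).2),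
          classWeightOfDatum₉ F N θ.toStage9Params (datumOfRecord₁₃CoPH F N θ hP) g₀ os (runA₁₃ F K₀ g₀ K) (histA₁₃ θ K₀ g₀ K) (K₀ + K) t s
        ≤ W K * ∑ s, classWeightOfDatum₉ F N θ.toStage9Params (datumOfRecord₁₃CoPH F N θ hP) g₀ os (runA₁₃ F K₀ g₀ K) (histA₁₃ θ K₀ g₀ K) (K₀ + K) t s)
    (hB : ∀ (K : ℕ) (t : ℝ), |t| ≤ 1 →
      ∑ s' ∈ Finset.univ.filter (fun s' : SeqOfRecord F θ.ν θ.τ9.M (histB₁₃ θ K₀ g₀ K) (K₀ + K + 1) (K₀ + K + 1) => KeyOldLargeField (jcut K) (keyB₁₃ θ K₀ g₀ K s').2),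
          classWeightOfDatum₉ F N θ.toStage9Params (datumOfRecord₁₃CoPH F N θ hP) g₀ os (runB₁₃ F K₀ g₀ K) (histB₁₃ θ K₀ g₀ K) (K₀ + K + 1) t s'
        ≤ W K * ∑ s', classWeightOfDatum₉ F N θ.toStage9Params (datumOfRecord₁₃CoPH F N θ hP) g₀ os (runB₁₃ F K₀ g₀ K) (histB₁₃ θ K₀ g₀ K) (K₀ + K + 1) t s') :
    RelWeightBound (crOfRecord₁₃At K₀ jcut sh F θ hP g₀ os).l₀ (crOfRecord₁₃At K₀ jcut sh F θ hP g₀ os).T (crOfRecord₁₃At K₀ jcut sh F θ hP g₀ os).A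
      (crOfRecord₁₃At K₀ jcut sh F θ hP g₀ os).B (crOfRecord₁₃At K₀ jcut sh F θ hP g₀ os).Bad (crOfRecord₁₃At K₀ jcut sh F θ hP g₀ os).W :=
  relWeightBound_crOfRecord₁₃At K₀ jcut sh θ hP g₀ os (relWeightBound_carriersOfRecord₁₃_of_termBounds θ hP K₀ g₀ os jcut hW0 hW1 hWs hA hB)

open Classical in
/-- ★★ **N20's FACE AT THE READING OF RECORD, ONE TUPLE, AS AN EQUIVALENCE**: `RelWeightBound` at `crOfRecord₁₃At K₀ jcut sh F θ hP g₀ os` ⟺ SOME `W` with `0 ≤ W < 1`,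
`Σ W < ∞` and the two term-level bounds (⇒: the reading's own canonical `W` is the witness, §1 converse; ⇐: the previous theorem). [bookkeeping] -/
theorem relWeightBound_crOfRecord₁₃At_iff_exists_termBounds (θ : Stage13HParams F N) (hP : θ.Provisos₁₃CoPH F N) (g₀ : ℕ → ℝ) (os : List (ULoop F)) :
    RelWeightBound (crOfRecord₁₃At K₀ jcut sh F θ hP g₀ os).l₀ (crOfRecord₁₃At K₀ jcut sh F θ hP g₀ os).T (crOfRecord₁₃At K₀ jcut sh F θ hP g₀ os).A
      (crOfRecord₁₃At K₀ jcut sh F θ hP g₀ os).B (crOfRecord₁₃At K₀ jcut sh F θ hP g₀ os).Bad (crOfRecord₁₃At K₀ jcut sh F θ hP g₀ os).W ↔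
    ∃ W : ℕ → ℝ, (∀ K, 0 ≤ W K) ∧ (∀ K, W K < 1) ∧ Summable W ∧
      (∀ (K : ℕ) (t : ℝ), |t| ≤ 1 →
        ∑ s ∈ Finset.univ.filter (fun s : SeqOfRecord F θ.ν θ.τ9.M (histA₁₃ θ K₀ g₀ K) (K₀ + K) (K₀ + K) => KeyOldLargeField (jcut K) (keyA₁₃ θ K₀ g₀ K s).2),
            classWeightOfDatum₉ F N θ.toStage9Params (datumOfRecord₁₃CoPH F N θ hP) g₀ os (runA₁₃ F K₀ g₀ K) (histA₁₃ θ K₀ g₀ K) (K₀ + K) t s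
          ≤ W K * ∑ s, classWeightOfDatum₉ F N θ.toStage9Params (datumOfRecord₁₃CoPH F N θ hP) g₀ os (runA₁₃ F K₀ g₀ K) (histA₁₃ θ K₀ g₀ K) (K₀ + K) t s) ∧
      (∀ (K : ℕ) (t : ℝ), |t| ≤ 1 →
        ∑ s' ∈ Finset.univ.filter (fun s' : SeqOfRecord F θ.ν θ.τ9.M (histB₁₃ θ K₀ g₀ K) (K₀ + K + 1) (K₀ + K + 1) => KeyOldLargeField (jcut K) (keyB₁₃ θ K₀ g₀ K s').2),
            classWeightOfDatum₉ F N θ.toStage9Params (datumOfRecord₁₃CoPH F N θ hP) g₀ os (runB₁₃ F K₀ g₀ K) (histB₁₃ θ K₀ g₀ K) (K₀ + K + 1) t s'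
          ≤ W K * ∑ s', classWeightOfDatum₉ F N θ.toStage9Params (datumOfRecord₁₃CoPH F N θ hP) g₀ os (runB₁₃ F K₀ g₀ K) (histB₁₃ θ K₀ g₀ K) (K₀ + K + 1) t s') := by
  constructor
  · intro h
    refine ⟨(crOfRecord₁₃At K₀ jcut sh F θ hP g₀ os).W, h.nonneg, h.lt_one, h.summable, ?_⟩
    exact termBounds_of_relWeightBound_carriersOfRecord₁₃ θ hP K₀ g₀ os jcut h
  · rintro ⟨W, hW0, hW1, hWs, hA, hB⟩
    exact relWeightBound_crOfRecord₁₃At_of_termBounds K₀ jcut sh θ hP g₀ os hW0 hW1 hWs hA hB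

open Classical in
/-- ★★ **THE NODE AT THE READING OF RECORD**: `S_N20 (SRec₁₃CoPH (crOfRecord₁₃At K₀ jcut sh))` — the K5 stub N20 = NE7b's `RelWeightBound` at every admissible Stage-13 tuple
with provisos, every `g₀`, `os` (dag-n19-d `s_N20_sRec₁₃CoPH_iff`) — ⟺ at every such tuple SOME `W` with `0 ≤ W < 1`, `Σ W < ∞` bounds the relative class weight of run A's
(2.18) sequences with an old large-field region at a level `≤ jcut K` and of run B's.  The right-hand side is N20's body at this reading (NOT PROVED; see the pin constraint).
[bookkeeping] -/
theorem s_N20_sRec₁₃CoPH_crOfRecord₁₃At_iff :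
    S_N20 (SRec₁₃CoPH (crOfRecord₁₃At K₀ jcut sh)) ↔
    ∀ (F : T4Family) (θ : Stage13HParams F N) (hP : θ.Provisos₁₃CoPH F N), θ.Admissible F N → ∀ (g₀ : ℕ → ℝ) (os : List (ULoop F)),
      ∃ W : ℕ → ℝ, (∀ K, 0 ≤ W K) ∧ (∀ K, W K < 1) ∧ Summable W ∧
        (∀ (K : ℕ) (t : ℝ), |t| ≤ 1 →
          ∑ s ∈ Finset.univ.filter (fun s : SeqOfRecord F θ.ν θ.τ9.M (histA₁₃ θ K₀ g₀ K) (K₀ + K) (K₀ + K) => KeyOldLargeField (jcut K) (keyA₁₃ θ K₀ g₀ K s).2),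
              classWeightOfDatum₉ F N θ.toStage9Params (datumOfRecord₁₃CoPH F N θ hP) g₀ os (runA₁₃ F K₀ g₀ K) (histA₁₃ θ K₀ g₀ K) (K₀ + K) t s
            ≤ W K * ∑ s, classWeightOfDatum₉ F N θ.toStage9Params (datumOfRecord₁₃CoPH F N θ hP) g₀ os (runA₁₃ F K₀ g₀ K) (histA₁₃ θ K₀ g₀ K) (K₀ + K) t s) ∧
        (∀ (K : ℕ) (t : ℝ), |t| ≤ 1 →
          ∑ s' ∈ Finset.univ.filter (fun s' : SeqOfRecord F θ.ν θ.τ9.M (histB₁₃ θ K₀ g₀ K) (K₀ + K + 1) (K₀ + K + 1) => KeyOldLargeField (jcut K) (keyB₁₃ θ K₀ g₀ K s').2),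
              classWeightOfDatum₉ F N θ.toStage9Params (datumOfRecord₁₃CoPH F N θ hP) g₀ os (runB₁₃ F K₀ g₀ K) (histB₁₃ θ K₀ g₀ K) (K₀ + K + 1) t s'
            ≤ W K * ∑ s', classWeightOfDatum₉ F N θ.toStage9Params (datumOfRecord₁₃CoPH F N θ hP) g₀ os (runB₁₃ F K₀ g₀ K) (histB₁₃ θ K₀ g₀ K) (K₀ + K + 1) t s') := by
  rw [s_N20_sRec₁₃CoPH_iff]
  refine forall_congr' fun F => forall_congr' fun θ => forall_congr' fun hP => forall_congr' fun _ => forall_congr' fun g₀ => forall_congr' fun os => ?_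
  exact relWeightBound_crOfRecord₁₃At_iff_exists_termBounds K₀ jcut sh θ hP g₀ os

variable (Rg : (F : T4Family) → Stage13HParams F N → Prop)

open Classical in
/-- ★★ **LEAF D's ∕ THE K3 SKELETON's `KeyedRelWeight` BINDER SHAPE AT `cr := crOfRecord₁₃At K₀ jcut sh`, REGIME-GUARDED** (`Rg F θ`, e.g. the item's guard `θ.ZhUnity F N ∧
θ.SlotsNondegenerate₁₃ F N`): from the per-tuple witnesses on the regime. [bookkeeping] -/
theorem relWeightBound_guarded_crOfRecord₁₃At_of_termBounds
    (hterm : ∀ (F : T4Family) (θ : Stage13HParams F N) (hP : θ.Provisos₁₃CoPH F N), Rg F θ → θ.Admissible F N → ∀ (g₀ : ℕ → ℝ) (os : List (ULoop F)),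
      ∃ W : ℕ → ℝ, (∀ K, 0 ≤ W K) ∧ (∀ K, W K < 1) ∧ Summable W ∧
        (∀ (K : ℕ) (t : ℝ), |t| ≤ 1 →
          ∑ s ∈ Finset.univ.filter (fun s : SeqOfRecord F θ.ν θ.τ9.M (histA₁₃ θ K₀ g₀ K) (K₀ + K) (K₀ + K) => KeyOldLargeField (jcut K) (keyA₁₃ θ K₀ g₀ K s).2),
              classWeightOfDatum₉ F N θ.toStage9Params (datumOfRecord₁₃CoPH F N θ hP) g₀ os (runA₁₃ F K₀ g₀ K) (histA₁₃ θ K₀ g₀ K) (K₀ + K) t s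
            ≤ W K * ∑ s, classWeightOfDatum₉ F N θ.toStage9Params (datumOfRecord₁₃CoPH F N θ hP) g₀ os (runA₁₃ F K₀ g₀ K) (histA₁₃ θ K₀ g₀ K) (K₀ + K) t s) ∧
        (∀ (K : ℕ) (t : ℝ), |t| ≤ 1 →
          ∑ s' ∈ Finset.univ.filter (fun s' : SeqOfRecord F θ.ν θ.τ9.M (histB₁₃ θ K₀ g₀ K) (K₀ + K + 1) (K₀ + K + 1) => KeyOldLargeField (jcut K) (keyB₁₃ θ K₀ g₀ K s').2),
              classWeightOfDatum₉ F N θ.toStage9Params (datumOfRecord₁₃CoPH F N θ hP) g₀ os (runB₁₃ F K₀ g₀ K) (histB₁₃ θ K₀ g₀ K) (K₀ + K + 1) t s'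
            ≤ W K * ∑ s', classWeightOfDatum₉ F N θ.toStage9Params (datumOfRecord₁₃CoPH F N θ hP) g₀ os (runB₁₃ F K₀ g₀ K) (histB₁₃ θ K₀ g₀ K) (K₀ + K + 1) t s'))
    (F : T4Family) (θ : Stage13HParams F N) (hP : θ.Provisos₁₃CoPH F N) (hRg : Rg F θ) (hθ : θ.Admissible F N) (g₀ : ℕ → ℝ) (os : List (ULoop F)) :
    RelWeightBound (crOfRecord₁₃At K₀ jcut sh F θ hP g₀ os).l₀ (crOfRecord₁₃At K₀ jcut sh F θ hP g₀ os).T (crOfRecord₁₃At K₀ jcut sh F θ hP g₀ os).A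
      (crOfRecord₁₃At K₀ jcut sh F θ hP g₀ os).B (crOfRecord₁₃At K₀ jcut sh F θ hP g₀ os).Bad (crOfRecord₁₃At K₀ jcut sh F θ hP g₀ os).W := by
  obtain ⟨W, hW0, hW1, hWs, hA, hB⟩ := hterm F θ hP hRg hθ g₀ os
  exact relWeightBound_crOfRecord₁₃At_of_termBounds K₀ jcut sh θ hP g₀ os hW0 hW1 hWs hA hB

open Classical in
/-- ★★ **THE NODE AT THE REGIME-RESTRICTED HOME** `S_N20 (SRec₁₃CoPHOn (crOfRecord₁₃At K₀ jcut sh) Rg)` (dag-n19-d `s_N20_sRec₁₃CoPHOn_iff`) from the per-tuple witnesses on the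
regime. [bookkeeping] -/
theorem s_N20_sRec₁₃CoPHOn_crOfRecord₁₃At_of_termBounds
    (hterm : ∀ (F : T4Family) (θ : Stage13HParams F N) (hP : θ.Provisos₁₃CoPH F N), Rg F θ → θ.Admissible F N → ∀ (g₀ : ℕ → ℝ) (os : List (ULoop F)),
      ∃ W : ℕ → ℝ, (∀ K, 0 ≤ W K) ∧ (∀ K, W K < 1) ∧ Summable W ∧
        (∀ (K : ℕ) (t : ℝ), |t| ≤ 1 →
          ∑ s ∈ Finset.univ.filter (fun s : SeqOfRecord F θ.ν θ.τ9.M (histA₁₃ θ K₀ g₀ K) (K₀ + K) (K₀ + K) => KeyOldLargeField (jcut K) (keyA₁₃ θ K₀ g₀ K s).2),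
              classWeightOfDatum₉ F N θ.toStage9Params (datumOfRecord₁₃CoPH F N θ hP) g₀ os (runA₁₃ F K₀ g₀ K) (histA₁₃ θ K₀ g₀ K) (K₀ + K) t s
            ≤ W K * ∑ s, classWeightOfDatum₉ F N θ.toStage9Params (datumOfRecord₁₃CoPH F N θ hP) g₀ os (runA₁₃ F K₀ g₀ K) (histA₁₃ θ K₀ g₀ K) (K₀ + K) t s) ∧
        (∀ (K : ℕ) (t : ℝ), |t| ≤ 1 →
          ∑ s' ∈ Finset.univ.filter (fun s' : SeqOfRecord F θ.ν θ.τ9.M (histB₁₃ θ K₀ g₀ K) (K₀ + K + 1) (K₀ + K + 1) => KeyOldLargeField (jcut K) (keyB₁₃ θ K₀ g₀ K s').2),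
              classWeightOfDatum₉ F N θ.toStage9Params (datumOfRecord₁₃CoPH F N θ hP) g₀ os (runB₁₃ F K₀ g₀ K) (histB₁₃ θ K₀ g₀ K) (K₀ + K + 1) t s'
            ≤ W K * ∑ s', classWeightOfDatum₉ F N θ.toStage9Params (datumOfRecord₁₃CoPH F N θ hP) g₀ os (runB₁₃ F K₀ g₀ K) (histB₁₃ θ K₀ g₀ K) (K₀ + K + 1) t s')) :
    S_N20 (SRec₁₃CoPHOn (crOfRecord₁₃At K₀ jcut sh) Rg) :=
  (s_N20_sRec₁₃CoPHOn_iff (crOfRecord₁₃At K₀ jcut sh) Rg).2 (relWeightBound_guarded_crOfRecord₁₃At_of_termBounds K₀ jcut sh Rg hterm)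

end Reading

/-! ## §3 The SHELL face at the same reading (module `…N21KeyedShellWeightSocket` §1 + dag-n20-d's `shellWeightBound_crOfRecord₁₃At`): a reading whose keyed shell split IS
the fibre sum of TERM-LEVEL shell pieces carries N21's `ShellWeightBound` from the term-level clauses -/

section ShellAtReading

variable (K₀ : ℕ) (jcut : ℕ → ℕ) (sh : ShellSplit₁₃CoPH N K₀)

/-- ★★ **N21's FACE AT THE READING OF RECORD, ONE TUPLE, FROM A TERM-LEVEL SHELL SPLIT.**  IF the reading's keyed shell split at the tuple is the fibre sum of term-level shell
pieces `σa ∕ σb` over `keyA₁₃ ∕ keyB₁₃` (displayed equations `hshA ∕ hshB`, dag-n20-d's classical `DecidableEq` spelling), `0 ≤ Wsh`, `Σ Wsh < ∞`, termwise `0 ≤ σ ≤` the class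
weight and — THE BODY OF N21, DISPLAYED, NOT PROVED — the two TOTAL shell bounds hold, THEN `ShellWeightBound` AT `crOfRecord₁₃At K₀ jcut sh F θ hP g₀ os` (its `Wsh` the
canonical one). [bookkeeping] -/
theorem shellWeightBound_crOfRecord₁₃At_of_termShell (θ : Stage13HParams F N) (hP : θ.Provisos₁₃CoPH F N) (g₀ : ℕ → ℝ) (os : List (ULoop F))
    (σa : (K : ℕ) → ℝ → SeqOfRecord F θ.ν θ.τ9.M (histA₁₃ θ K₀ g₀ K) (K₀ + K) (K₀ + K) → ℝ)
    (σb : (K : ℕ) → ℝ → SeqOfRecord F θ.ν θ.τ9.M (histB₁₃ θ K₀ g₀ K) (K₀ + K + 1) (K₀ + K + 1) → ℝ)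
    (hshA : letI : ∀ Kc, DecidableEq (SiteSeqKey F Kc) := fun _ => Classical.decEq _
      (sh F θ hP g₀ os).1 = fun K t x => ∑ s ∈ Finset.univ.filter (fun s => keyA₁₃ θ K₀ g₀ K s = x), σa K t s)
    (hshB : letI : ∀ Kc, DecidableEq (SiteSeqKey F Kc) := fun _ => Classical.decEq _
      (sh F θ hP g₀ os).2 = fun K t x => ∑ s' ∈ Finset.univ.filter (fun s' => keyB₁₃ θ K₀ g₀ K s' = x), σb K t s')
    {Wsh : ℕ → ℝ} (hW0 : ∀ K, 0 ≤ Wsh K) (hWs : Summable Wsh)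
    (hσa0 : ∀ (K : ℕ) (t : ℝ), |t| ≤ 1 → ∀ s, 0 ≤ σa K t s)
    (hσa : ∀ (K : ℕ) (t : ℝ), |t| ≤ 1 → ∀ s,
      σa K t s ≤ classWeightOfDatum₉ F N θ.toStage9Params (datumOfRecord₁₃CoPH F N θ hP) g₀ os (runA₁₃ F K₀ g₀ K) (histA₁₃ θ K₀ g₀ K) (K₀ + K) t s)
    (hσb0 : ∀ (K : ℕ) (t : ℝ), |t| ≤ 1 → ∀ s', 0 ≤ σb K t s')
    (hσb : ∀ (K : ℕ) (t : ℝ), |t| ≤ 1 → ∀ s',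
      σb K t s' ≤ classWeightOfDatum₉ F N θ.toStage9Params (datumOfRecord₁₃CoPH F N θ hP) g₀ os (runB₁₃ F K₀ g₀ K) (histB₁₃ θ K₀ g₀ K) (K₀ + K + 1) t s')
    (hA : ∀ (K : ℕ) (t : ℝ), |t| ≤ 1 →
      ∑ s, σa K t s ≤ Wsh K * ∑ s, classWeightOfDatum₉ F N θ.toStage9Params (datumOfRecord₁₃CoPH F N θ hP) g₀ os (runA₁₃ F K₀ g₀ K) (histA₁₃ θ K₀ g₀ K) (K₀ + K) t s)
    (hB : ∀ (K : ℕ) (t : ℝ), |t| ≤ 1 →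
      ∑ s', σb K t s' ≤ Wsh K * ∑ s', classWeightOfDatum₉ F N θ.toStage9Params (datumOfRecord₁₃CoPH F N θ hP) g₀ os (runB₁₃ F K₀ g₀ K) (histB₁₃ θ K₀ g₀ K) (K₀ + K + 1) t s') :
    ShellWeightBound (crOfRecord₁₃At K₀ jcut sh F θ hP g₀ os).l₀ (crOfRecord₁₃At K₀ jcut sh F θ hP g₀ os).T (crOfRecord₁₃At K₀ jcut sh F θ hP g₀ os).A
      (crOfRecord₁₃At K₀ jcut sh F θ hP g₀ os).B (crOfRecord₁₃At K₀ jcut sh F θ hP g₀ os).shA (crOfRecord₁₃At K₀ jcut sh F θ hP g₀ os).shB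
      (crOfRecord₁₃At K₀ jcut sh F θ hP g₀ os).Wsh := by
  letI : ∀ Kc, DecidableEq (SiteSeqKey F Kc) := fun _ => Classical.decEq _
  refine shellWeightBound_crOfRecord₁₃At K₀ jcut sh θ hP g₀ os (Wsh := Wsh) ?_
  rw [hshA, hshB]
  exact shellWeightBound_keyed_of_termShell (keyA₁₃ θ K₀ g₀) (keyB₁₃ θ K₀ g₀)
    (fun K t (s : SeqOfRecord F θ.ν θ.τ9.M (histA₁₃ θ K₀ g₀ K) (K₀ + K) (K₀ + K)) =>
      classWeightOfDatum₉ F N θ.toStage9Params (datumOfRecord₁₃CoPH F N θ hP) g₀ os (runA₁₃ F K₀ g₀ K) (histA₁₃ θ K₀ g₀ K) (K₀ + K) t s) σa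
    (fun K t (s' : SeqOfRecord F θ.ν θ.τ9.M (histB₁₃ θ K₀ g₀ K) (K₀ + K + 1) (K₀ + K + 1)) =>
      classWeightOfDatum₉ F N θ.toStage9Params (datumOfRecord₁₃CoPH F N θ hP) g₀ os (runB₁₃ F K₀ g₀ K) (histB₁₃ θ K₀ g₀ K) (K₀ + K + 1) t s') σb
    (keyA₁₃_mem_classSet₁₃ θ K₀ g₀) (keyB₁₃_mem_classSet₁₃ θ K₀ g₀) hW0 hWs hσa0 hσa hσb0 hσb hA hB

/-- ★★ **THE NODE N21 AT THE READING OF RECORD FROM TERM-LEVEL SHELL SPLITS**: if at every admissible Stage-13 tuple with provisos the reading's keyed shell split is the fibre sum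
of term-level pieces obeying the displayed clauses for SOME `Wsh` (`0 ≤ Wsh`, `Σ Wsh < ∞`), then `S_N21 (SRec₁₃CoPH (crOfRecord₁₃At K₀ jcut sh))` (dag-n19-d `s_N21_sRec₁₃CoPH_iff`).
[bookkeeping] -/
theorem s_N21_sRec₁₃CoPH_crOfRecord₁₃At_of_termShell
    (hterm : ∀ (F : T4Family) (θ : Stage13HParams F N) (hP : θ.Provisos₁₃CoPH F N), θ.Admissible F N → ∀ (g₀ : ℕ → ℝ) (os : List (ULoop F)),
      ∃ (σa : (K : ℕ) → ℝ → SeqOfRecord F θ.ν θ.τ9.M (histA₁₃ θ K₀ g₀ K) (K₀ + K) (K₀ + K) → ℝ)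
        (σb : (K : ℕ) → ℝ → SeqOfRecord F θ.ν θ.τ9.M (histB₁₃ θ K₀ g₀ K) (K₀ + K + 1) (K₀ + K + 1) → ℝ) (Wsh : ℕ → ℝ),
        (letI : ∀ Kc, DecidableEq (SiteSeqKey F Kc) := fun _ => Classical.decEq _
         (sh F θ hP g₀ os).1 = fun K t x => ∑ s ∈ Finset.univ.filter (fun s => keyA₁₃ θ K₀ g₀ K s = x), σa K t s) ∧
        (letI : ∀ Kc, DecidableEq (SiteSeqKey F Kc) := fun _ => Classical.decEq _
         (sh F θ hP g₀ os).2 = fun K t x => ∑ s' ∈ Finset.univ.filter (fun s' => keyB₁₃ θ K₀ g₀ K s' = x), σb K t s') ∧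
        (∀ K, 0 ≤ Wsh K) ∧ Summable Wsh ∧
        (∀ (K : ℕ) (t : ℝ), |t| ≤ 1 → ∀ s, 0 ≤ σa K t s) ∧
        (∀ (K : ℕ) (t : ℝ), |t| ≤ 1 → ∀ s,
          σa K t s ≤ classWeightOfDatum₉ F N θ.toStage9Params (datumOfRecord₁₃CoPH F N θ hP) g₀ os (runA₁₃ F K₀ g₀ K) (histA₁₃ θ K₀ g₀ K) (K₀ + K) t s) ∧
        (∀ (K : ℕ) (t : ℝ), |t| ≤ 1 → ∀ s', 0 ≤ σb K t s') ∧
        (∀ (K : ℕ) (t : ℝ), |t| ≤ 1 → ∀ s',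
          σb K t s' ≤ classWeightOfDatum₉ F N θ.toStage9Params (datumOfRecord₁₃CoPH F N θ hP) g₀ os (runB₁₃ F K₀ g₀ K) (histB₁₃ θ K₀ g₀ K) (K₀ + K + 1) t s') ∧
        (∀ (K : ℕ) (t : ℝ), |t| ≤ 1 →
          ∑ s, σa K t s ≤ Wsh K * ∑ s, classWeightOfDatum₉ F N θ.toStage9Params (datumOfRecord₁₃CoPH F N θ hP) g₀ os (runA₁₃ F K₀ g₀ K) (histA₁₃ θ K₀ g₀ K) (K₀ + K) t s) ∧
        (∀ (K : ℕ) (t : ℝ), |t| ≤ 1 →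
          ∑ s', σb K t s' ≤ Wsh K * ∑ s', classWeightOfDatum₉ F N θ.toStage9Params (datumOfRecord₁₃CoPH F N θ hP) g₀ os (runB₁₃ F K₀ g₀ K) (histB₁₃ θ K₀ g₀ K) (K₀ + K + 1) t s')) :
    S_N21 (SRec₁₃CoPH (crOfRecord₁₃At K₀ jcut sh)) := by
  rw [s_N21_sRec₁₃CoPH_iff]
  intro F θ hP hθ g₀ os
  obtain ⟨σa, σb, Wsh, hshA, hshB, hW0, hWs, hσa0, hσa, hσb0, hσb, hA, hB⟩ := hterm F θ hP hθ g₀ os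
  exact shellWeightBound_crOfRecord₁₃At_of_termShell K₀ jcut sh θ hP g₀ os σa σb hshA hshB hW0 hWs hσa0 hσa hσb0 hσb hA hB

end ShellAtReading

end Summit.QuantumFields.YangMills.BalabanUVNodes.N20KeyedRelWeightSocketAtRecord13CoPH

end
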